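import Mathlib
import Literature.MathematicalPhysics.StatisticalMechanics.LennardJonesClusters
import Literature.MathematicalPhysics.StatisticalMechanics.MatchedWindowTransfer
import Literature.MathematicalPhysics.StatisticalMechanics.MatchedWindowPairTransfer
import Summits.AtomisticToContinuum.Crystallization.Theorems.SquareWellLayerCakeStackingFaultSparsityDefs
import Summits.AtomisticToContinuum.Crystallization.Theorems.SquareWellLayerCakeStackingFaultSparsityCompetitorInjective
import Summits.AtomisticToContinuum.Crystallization.Theorems.PricedLinkCensusStackingHingeFarTail
import Summits.AtomisticToContinuum.Crystallization.Theorems.PricedLinkCensusStackingHingeSiteEnergyNearMatched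
import Summits.AtomisticToContinuum.Crystallization.Theorems.MinMeanCycleStackingLockBarlowEnergyIdentification

/-!
# Perturbative transfer (stub `stub_perturbativeTransfer` of `StackingFaultSparsity`, line `Sketch`)

Crux `StackingFaultSparsity` (item stmt-AtomisticToContinuum-14296, routes `SquareWellLayerCake` /
`LaminarSixThreeThree`), survey obligation M3d of the dilute-faults reshape.  A `d₀`-separated
configuration `x` has the window of `i` two-way `(L, ε₁)`-matched (`ε₁ ≤ d₀/4`, `ε₁ < 1/8`) to the
box stacking `barlowStacking a h s` based at `z = barlowPos k i₀ j₀` after the isometry `A`;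
`P` enumerates the stacking points within `R` of the block base `b = barlowPos q₁ i₀ j₀`, the ball
`B(b, R + 1)` inside the window and `R ≥ ρ + (q₂ - q₁) h + K h + 1`.  Then the changed-pair sums of
the cylinder flip `blockShift` on `x` and of `latticeShift` on `P` differ by at most
`C_p ε₁ ρ² (q₂ - q₁) + C_T ρ² (q₂ - q₁) K⁻³`.

Proof.  The matching `m ↦ φ m` (the particle within `ε₁` of the image of `P m`) is an embedding
`Fin N' ↪ Fin N` (`exists_matching_embedding`, Literature `MatchedWindowTransfer`); on its image
`blockShift (φ m) = A (latticeShift m)` (`blockShift_eq_of_near`), off its image `blockShift = 0`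
(cylinder points are within `R` of `b`), and a particle off the image is `≥ K h + 3/4` from every
moved particle (outside `B(b, R)` or outside the window).  The lattice displacement is
`latticeShift m = c_m • w` with `c_m ∈ {0, ±1}` (`σ_n` on the cylinder, `0` off it), so the four
configurations `x ∘ φ`, `P`, `x ∘ φ + A ∘ δ`, `P + δ` on `Fin N'` are `r₀ = min d₀ (1/4)`-separated
(sites `≥ a`, layers `≥ h`, holes `≥ a/√3` from sites — `half_le_dist_shifted`; particles within
`ε₁` of images) and matched distances agree within `2 ε₁` before and after the shift.  These are
exactly the hypotheses of the abstract transfer estimate `abs_changedPairs_sub_changedPairs_le`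
(Literature `MatchedWindowPairTransfer`: Lipschitz comparison of matched pairs with the shell sums,
far tails `stub_farTail` at range `K h` for the unmatched partners), which bounds the difference by
`#{m : latticeShift m ≠ 0} · (2000 C_L r₀⁻⁶ ε₁ + 195 C_T (K h)⁻³)`; the moved `m` index cylinder
points, at most `(q₂ - q₁)(8ρ/a + 1)² ≤ 100 ρ² (q₂ - q₁)` of them (`card_le_of_lateral_sq_le`), and
`h⁻³ ≤ 3` on the box.
-/

noncomputable section
namespace Summit.AtomisticToContinuum.Crystallization.Theorems.SquareWellLayerCake.StackingFaultSparsity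
open Literature.MathematicalPhysics.StatisticalMechanics
/-- Euclidean `3`-space. [folklore] -/
local notation "E3" => EuclideanSpace ℝ (Fin 3)

open PricedHcpWindowsSiteEnergyContinuity (abs_lennardJones_sub_le abs_lennardJones_le_of_one_le)

/-! ## Shifted lattice windows stay separated -/

/-- In one layer, a hole `p + σ w` (`σ = ±1`) is `≥ a/√3` from every site `p'`:
`a²/3 ≤ dist (p + σ w) p' ²` (`hole_form_nonneg`). [folklore] -/
private theorem sq_div_three_le_dist_sq_hole (a h : ℝ) (s : ℤ → ℤ) {σ : ℤ} (hσ : σ = 1 ∨ σ = -1)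
    (n e f e' f' : ℤ) :
    a ^ 2 / 3 ≤ dist (barlowPos a h s n e f + (σ : ℝ) • barlowOffset a) (barlowPos a h s n e' f') ^ 2 := by
  -- adapted from `quarter_lt_dist_hole` (CompetitorInjective)
  have h3 : (√3 : ℝ) ^ 2 = 3 := Real.sq_sqrt (by norm_num)
  have hσ2 : (σ : ℝ) ^ 2 = 1 := by rcases hσ with rfl | rfl <;> norm_num
  have hm : (0 : ℝ) ≤ ((e - e') ^ 2 + (e - e') * (f - f') + (f - f') ^ 2 +
      σ * ((e - e') + (f - f')) : ℤ) := by exact_mod_cast hole_form_nonneg (e - e') (f - f') hσ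
  have hrepr : dist (barlowPos a h s n e f + (σ : ℝ) • barlowOffset a) (barlowPos a h s n e' f') ^ 2 =
      a ^ 2 * ((e - e') ^ 2 + (e - e') * (f - f') + (f - f') ^ 2 +
        σ * ((e - e') + (f - f')) : ℤ) + a ^ 2 / 3 := by
    have h0 := dist_barlowPos_add_smul_sq a h s σ 0 n e f n e' f'
    rw [zero_smul, add_zero] at h0
    rw [h0]
    push_cast
    linear_combination (a ^ 2 / 4 * (((f : ℝ) - f') + (σ : ℝ) / 3) ^ 2) * h3 +
      (a ^ 2 / 3) * hσ2
  rw [hrepr]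
  nlinarith [mul_nonneg (sq_nonneg a) hm]

open Classical in
/-- **Shifted window points stay `≥ 1/2` apart** (box parameters): two distinct stacking points,
each shifted by its lattice displacement (`σ_n w` on the cylinder, `0` off it), are at distance
`≥ 1/2` — different layers `≥ h`, same layer and same shift `≥ a`, same layer and shifts `σ w ≠ 0`
versus `0` at least the hole distance `a/√3`. [folklore] -/
private theorem half_le_dist_shifted {a h : ℝ} (hbox : InBox a h) (s : ℤ → ℤ) (q₁ q₂ i₀ j₀ : ℤ)
    (ρ : ℝ) {n e f n' e' f' : ℤ} (hne : (n, e, f) ≠ (n', e', f')) :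
    1 / 2 ≤ dist
      (barlowPos a h s n e f +
        ((if InCyl a h s q₁ q₂ i₀ j₀ ρ n e f then shiftSign s q₁ n else 0 : ℤ) : ℝ) • barlowOffset a)
      (barlowPos a h s n' e' f' +
        ((if InCyl a h s q₁ q₂ i₀ j₀ ρ n' e' f' then shiftSign s q₁ n' else 0 : ℤ) : ℝ) •
          barlowOffset a) := by
  have hbox' := hbox
  obtain ⟨ha0, ha1, hh0, -⟩ := hbox'
  have ha : 0 ≤ a := by linarith
  have hh : 0 ≤ h := by linarith
  by_cases hn : n = n'
  · subst hn
    have hef : (e, f) ≠ (e', f') := by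
      intro h0
      apply hne
      simp only [Prod.mk.injEq] at h0
      rw [h0.1, h0.2]
    have hsite : 1 / 2 ≤ dist (barlowPos a h s n e f) (barlowPos a h s n e' f') :=
      le_trans (by linarith) (le_dist_barlowPos_of_ne a h s ha hef)
    -- hole versus site, in either order
    have hhole : ∀ {σ : ℤ}, σ = 1 ∨ σ = -1 → ∀ e₁ f₁ e₂ f₂ : ℤ,
        1 / 2 ≤ dist (barlowPos a h s n e₁ f₁ + (σ : ℝ) • barlowOffset a) (barlowPos a h s n e₂ f₂) := by
      intro σ hσ e₁ f₁ e₂ f₂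
      have h1 := sq_div_three_le_dist_sq_hole a h s hσ n e₁ f₁ e₂ f₂
      have h2 : (1 / 2 : ℝ) ^ 2 ≤
          dist (barlowPos a h s n e₁ f₁ + (σ : ℝ) • barlowOffset a) (barlowPos a h s n e₂ f₂) ^ 2 := by
        nlinarith
      exact (pow_le_pow_iff_left₀ (by norm_num) dist_nonneg two_ne_zero).1 h2
    by_cases hc : InCyl a h s q₁ q₂ i₀ j₀ ρ n e f <;>
      by_cases hc' : InCyl a h s q₁ q₂ i₀ j₀ ρ n e' f' <;>
      simp only [hc, hc', if_true, if_false, Int.cast_zero, zero_smul, add_zero]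
    · rwa [dist_add_right]
    · rcases shiftSign_cases s q₁ n with h0 | hσ
      · rw [h0, Int.cast_zero, zero_smul, add_zero]; exact hsite
      · exact hhole hσ e f e' f'
    · rcases shiftSign_cases s q₁ n with h0 | hσ
      · rw [h0, Int.cast_zero, zero_smul, add_zero]; exact hsite
      · rw [dist_comm]; exact hhole hσ e' f' e f
    · exact hsite
  · exact le_trans (by linarith) (le_dist_barlowPos_add_smul_of_ne hh s _ _ hn e f e' f')

/-! ## The stub -/

open Classical in
/-- **Stub `stub_perturbativeTransfer`** (survey M3d): for a `d₀`-separated configuration whose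
window is two-way `(L, ε₁)`-matched to a box stacking (`ε₁ ≤ d₀/4`, `ε₁ < 1/8`) and the
enumeration `P` of the stacking points within `R` of the block base (`R ≥ ρ + (q₂ - q₁ + K) h + 1`,
the ball `R + 1` around the base inside the `L`-window), the changed-pair sums of `blockShift` on
`x` and of `latticeShift` on `P` differ by at most `C_p ε₁ ρ² (q₂ - q₁) + C_T ρ² (q₂ - q₁) K⁻³`
(matching embedding, Lipschitz comparison of matched pairs with shell sums, far tails for the
unmatched partners, cylinder count). [folklore] -/
theorem stub_perturbativeTransfer :
    (∀ d₀ : ℝ, 0 < d₀ → ∃ (C_p C_T : ℝ), 0 ≤ C_p ∧ 0 ≤ C_T ∧ ∀ K : ℕ, 2 ≤ K →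
      ∀ (a h : ℝ) (s : ℤ → ℤ) (k i₀ j₀ q₁ q₂ : ℤ) (ρ ε₁ L R : ℝ) {N : ℕ} (x : Fin N → E3)
        (i : Fin N) (A : E3 →ₗᵢ[ℝ] E3) {N' : ℕ} (P : Fin N' → E3),
        InBox a h → IsHaggSeq s → q₁ < q₂ → 0 < ε₁ → ε₁ ≤ d₀ / 4 → ε₁ < 1 / 8 → 1 ≤ ρ →
        ρ + ((q₂ : ℝ) - q₁) * h + K * h + 1 ≤ R →
        dist (barlowPos a h s q₁ i₀ j₀) (barlowPos a h s k i₀ j₀) + R + 1 ≤ L →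
        (∀ j j' : Fin N, j ≠ j' → d₀ ≤ dist (x j) (x j')) →
        TwoWay (barlowStacking a h s) L ε₁ x i (barlowPos a h s k i₀ j₀) A →
        Function.Injective P →
        Set.range P = {p ∈ barlowStacking a h s | dist p (barlowPos a h s q₁ i₀ j₀) ≤ R} →
        |changedPairSum lennardJones x (blockShift a h s k i₀ j₀ q₁ q₂ ρ ε₁ x i A) -
            changedPairSum lennardJones P (latticeShift a h s q₁ q₂ i₀ j₀ ρ P)| ≤
          C_p * ε₁ * ρ ^ 2 * ((q₂ : ℝ) - q₁) + C_T * ρ ^ 2 * ((q₂ : ℝ) - q₁) * (K : ℝ)⁻¹ ^ 3) := by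
  intro d₀ hd₀
  -- constants
  obtain ⟨r₀, hr₀⟩ : ∃ r₀ : ℝ, r₀ = min d₀ (1 / 4) := ⟨_, rfl⟩
  have hr₀0 : 0 < r₀ := by rw [hr₀]; exact lt_min hd₀ (by norm_num)
  have hr₀d : r₀ ≤ d₀ := hr₀ ▸ min_le_left _ _
  have hr₀q : r₀ ≤ 1 / 4 := hr₀ ▸ min_le_right _ _
  obtain ⟨CT, hCT0, hCT⟩ := PricedHcpWindowsFarTail.stub_farTail r₀ hr₀0
  obtain ⟨CL, hCL⟩ : ∃ CL : ℝ, CL = r₀⁻¹ ^ 7 + r₀⁻¹ := ⟨_, rfl⟩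
  have hCL0 : 0 ≤ CL := by rw [hCL]; positivity
  refine ⟨100 * (2000 * CL * r₀⁻¹ ^ 6), 100 * (585 * CT), by positivity, by positivity, ?_⟩
  intro K hK a h s k i₀ j₀ q₁ q₂ ρ ε₁ L R N x i A N' P hbox hs hq hε0 hεd hε8 hρ hR hL hsep hW hPinj
    hPr
  have hbox' := hbox
  obtain ⟨ha0, ha1, hh0, hh1⟩ := hbox'
  have ha : 0 < a := by linarith
  have hh7 : 7 / 10 ≤ h := by linarith
  have hh : 0 < h := by linarith
  have hK2 : (2 : ℝ) ≤ K := by exact_mod_cast hK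
  have hKh : 7 / 5 ≤ (K : ℝ) * h := by
    have := mul_le_mul_of_nonneg_right hK2 hh.le
    linarith
  have hq0 : (0 : ℝ) ≤ (q₂ : ℝ) - q₁ := by
    have : (q₁ : ℝ) ≤ q₂ := by exact_mod_cast hq.le
    linarith
  have hRc : ρ + ((q₂ : ℝ) - q₁) * h ≤ R := by
    have : 0 ≤ (K : ℝ) * h := by positivity
    linarith
  set z : E3 := barlowPos a h s k i₀ j₀
  set b : E3 := barlowPos a h s q₁ i₀ j₀
  set w : E3 := barlowOffset a
  set S : Set E3 := barlowStacking a h s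
  set dX : Fin N → E3 := blockShift a h s k i₀ j₀ q₁ q₂ ρ ε₁ x i A
  set dP : Fin N' → E3 := latticeShift a h s q₁ q₂ i₀ j₀ ρ P
  set g : E3 → E3 := fun p => x i + A (p - z) with hgdef
  have hgd : ∀ p q, dist (g p) (g q) = dist p q := fun p q => dist_chart_eq (x i) z p q A
  have hgz : g z = x i := by simp [hgdef]
  have hSsep : ∀ p ∈ S, ∀ q ∈ S, p ≠ q → min a h ≤ dist p q := fun p hp q hq' hne =>
    le_dist_of_mem_barlowStacking a h s ha.le hh.le hp hq' hne
  have hεS : 2 * ε₁ < min a h :=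
    lt_of_lt_of_le (b := 1 / 4) (by linarith) (le_min (by linarith) (by linarith))
  have hεd' : 2 * ε₁ < d₀ := by linarith
  have hinj3 : ∀ n e f n' e' f' : ℤ, barlowPos a h s n e f = barlowPos a h s n' e' f' →
      n = n' ∧ e = e' ∧ f = f' := by
    intro n e f n' e' f' heq
    have := barlowPos_injective ha hh s (a₁ := (n, e, f)) (a₂ := (n', e', f')) heq
    simpa [Prod.mk.injEq] using this
  -- the matching embedding
  obtain ⟨φ, hφ, -, hφrange, hφfar⟩ := exists_matching_embedding (x := x) (S := S) (g := g)
    (P := P) hgd hgz hsep hSsep hε0.le hεd' hεS hW.1 hW.2 hPinj hPr hL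
  have hPm : ∀ m, P m ∈ S ∧ dist (P m) b ≤ R := fun m => (Set.ext_iff.1 hPr (P m)).1 ⟨m, rfl⟩
  choose nn ee ff hP using fun m => mem_barlowStacking_iff.1 (hPm m).1
  have hinjτ : ∀ m m', (nn m, ee m, ff m) = (nn m', ee m', ff m') → m = m' := by
    intro m m' h0
    simp only [Prod.mk.injEq] at h0
    apply hPinj
    rw [hP m, hP m', h0.1, h0.2.1, h0.2.2]
  -- the lattice displacement in closed form
  set c : Fin N' → ℤ := fun m =>
    if InCyl a h s q₁ q₂ i₀ j₀ ρ (nn m) (ee m) (ff m) then shiftSign s q₁ (nn m) else 0 with hc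
  have hdP : ∀ m, dP m = (c m : ℝ) • w := by
    intro m
    by_cases hcyl : InCyl a h s q₁ q₂ i₀ j₀ ρ (nn m) (ee m) (ff m)
    · have hj : ∃ n i' j', InCyl a h s q₁ q₂ i₀ j₀ ρ n i' j' ∧ P m = barlowPos a h s n i' j' :=
        ⟨_, _, _, hcyl, hP m⟩
      have e1 : dP m = (shiftSign s q₁ hj.choose : ℝ) • w := by
        show latticeShift a h s q₁ q₂ i₀ j₀ ρ P m = _
        unfold latticeShift
        rw [dif_pos hj]
      obtain ⟨i', j', -, hPm'⟩ := hj.choose_spec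
      obtain ⟨hn, -, -⟩ := hinj3 _ _ _ _ _ _ (hPm'.symm.trans (hP m))
      rw [e1, hn]
      simp only [hc, if_pos hcyl]
    · have hj : ¬ ∃ n i' j', InCyl a h s q₁ q₂ i₀ j₀ ρ n i' j' ∧ P m = barlowPos a h s n i' j' := by
        rintro ⟨n, i', j', hc', hPm'⟩
        obtain ⟨rfl, rfl, rfl⟩ := hinj3 _ _ _ _ _ _ (hPm'.symm.trans (hP m))
        exact hcyl hc'
      have e1 : dP m = 0 := by
        show latticeShift a h s q₁ q₂ i₀ j₀ ρ P m = _
        unfold latticeShift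
        rw [dif_neg hj]
      rw [e1]
      simp only [hc, if_neg hcyl, Int.cast_zero, zero_smul]
  have hcm : ∀ m, c m = 0 ∨ (c m = 1 ∨ c m = -1) := by
    intro m
    simp only [hc]
    split_ifs
    · exact shiftSign_cases s q₁ _
    · exact Or.inl rfl
  have hdP0 : ∀ m, dP m ≠ 0 →
      InCyl a h s q₁ q₂ i₀ j₀ ρ (nn m) (ee m) (ff m) ∧ (c m = 1 ∨ c m = -1) := by
    intro m hm
    by_cases hcyl : InCyl a h s q₁ q₂ i₀ j₀ ρ (nn m) (ee m) (ff m)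
    · refine ⟨hcyl, (hcm m).resolve_left fun h0 => hm ?_⟩
      rw [hdP, h0, Int.cast_zero, zero_smul]
    · refine absurd ?_ hm
      rw [hdP]
      simp only [hc, if_neg hcyl, Int.cast_zero, zero_smul]
  -- the particle displacement on and off the image of `φ`
  have hdX : ∀ m, dX (φ m) = A (dP m) := by
    intro m
    have hφm : dist (x (φ m)) (x i + A (barlowPos a h s (nn m) (ee m) (ff m) - z)) ≤ ε₁ := by
      rw [← hP m]; exact hφ m
    by_cases hcyl : InCyl a h s q₁ q₂ i₀ j₀ ρ (nn m) (ee m) (ff m)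
    · rw [hdP]
      simp only [hc, if_pos hcyl]
      exact blockShift_eq_of_near hbox hε8 hcyl hφm
    · rcases blockShift_cases a h s k i₀ j₀ q₁ q₂ ρ ε₁ x i A (φ m) with
        ⟨n', e', f', hc', hd', -⟩ | ⟨-, hb'⟩
      · exfalso
        have heq : barlowPos a h s n' e' f' = P m :=
          eq_of_dist_image_le hgd hSsep hεS (barlowPos_mem _ _ _) (hPm m).1 hd' (hφ m)
        obtain ⟨rfl, rfl, rfl⟩ := hinj3 _ _ _ _ _ _ (heq.trans (hP m))
        exact hcyl hc'
      · rw [show dX (φ m) = 0 from hb', hdP]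
        simp only [hc, if_neg hcyl, Int.cast_zero, zero_smul, map_zero]
  have hdX0 : ∀ j, j ∉ Set.range φ → dX j = 0 := by
    intro j hj
    rcases blockShift_cases a h s k i₀ j₀ q₁ q₂ ρ ε₁ x i A j with
      ⟨n', e', f', hc', hd', -⟩ | ⟨-, hb'⟩
    · exact absurd (hφrange j _ (barlowPos_mem _ _ _) hd'
        ((dist_le_of_inCyl hh.le (by linarith) hc').trans hRc)) hj
    · exact hb'
  -- far partners of moved particles
  have hfar : ∀ m j, dP m ≠ 0 → j ∉ Set.range φ → (K : ℝ) * h + 3 / 4 ≤ dist (x (φ m)) (x j) := by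
    intro m j hm hj
    have h1 := hφfar m j hj
    have h2 : dist (P m) b ≤ ρ + ((q₂ : ℝ) - q₁) * h := by
      rw [hP m]; exact dist_le_of_inCyl hh.le (by linarith) (hdP0 m hm).1
    linarith
  -- the separations and closeness feeding the abstract transfer estimate
  have hsepr : ∀ j j', j ≠ j' → r₀ ≤ dist (x j) (x j') := fun j j' hne => hr₀d.trans (hsep j j' hne)
  have hsepP : ∀ m m', m ≠ m' → r₀ ≤ dist (P m) (P m') := fun m m' hne =>
    le_trans (by linarith [le_min (by linarith : (1:ℝ)/4 ≤ a) (by linarith : (1:ℝ)/4 ≤ h)])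
      (hSsep _ (hPm m).1 _ (hPm m').1 (hPinj.ne hne))
  have hsepQ2 : ∀ m m', m ≠ m' → 1 / 2 ≤ dist (P m + dP m) (P m' + dP m') := by
    intro m m' hne
    have hτ : (nn m, ee m, ff m) ≠ (nn m', ee m', ff m') := fun h0 => hne (hinjτ m m' h0)
    rw [hdP m, hdP m', hP m, hP m']
    exact half_le_dist_shifted hbox s q₁ q₂ i₀ j₀ ρ hτ
  have hsepQ : ∀ m m', m ≠ m' → r₀ ≤ dist (P m + dP m) (P m' + dP m') := fun m m' hne => by
    linarith [hsepQ2 m m' hne]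
  have hnear' : ∀ m, dist (x (φ m) + A (dP m)) (g (P m + dP m)) ≤ ε₁ := by
    intro m
    simp only [hgdef]
    rw [dist_add_chart_eq]
    exact hφ m
  have hclose : ∀ m m', |dist (x (φ m)) (x (φ m')) - dist (P m) (P m')| ≤ 2 * ε₁ := by
    intro m m'
    have := abs_dist_sub_dist_le_two_mul (hφ m) (hφ m')
    rwa [hgd] at this
  have hclose' : ∀ m m', |dist (x (φ m) + A (dP m)) (x (φ m') + A (dP m')) -
      dist (P m + dP m) (P m' + dP m')| ≤ 2 * ε₁ := by
    intro m m'
    have := abs_dist_sub_dist_le_two_mul (hnear' m) (hnear' m')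
    rwa [hgd] at this
  have hsepY : ∀ m m', m ≠ m' → r₀ ≤ dist (x (φ m) + A (dP m)) (x (φ m') + A (dP m')) := by
    intro m m' hne
    have h1 := hclose' m m'
    rw [abs_le] at h1
    linarith [hsepQ2 m m' hne, h1.1]
  have hnorm : ∀ m, ‖dP m‖ ≤ 3 / 5 := by
    intro m
    rw [hdP]
    rcases hcm m with h0 | h1
    · rw [h0, Int.cast_zero, zero_smul, norm_zero]; norm_num
    · exact norm_smul_barlowOffset_le (by linarith) ha1 h1
  -- the abstract transfer estimate
  have hKr : r₀ ≤ (K : ℝ) * h := by linarith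
  have hmain := abs_changedPairs_sub_changedPairs_le lennardJones x dX P dP φ A hr₀0 hCL0 hCT0
    hε0.le hKh hKr (fun u v hu hv => hCL ▸ abs_lennardJones_sub_le hr₀0 hu hv)
    (fun r hr => abs_lennardJones_le_of_one_le hr) hsepr (hCT N x hsepr) hdX hdX0 hsepP hsepQ
    hsepY hclose hclose' hnorm hfar
  -- the number of moved window points: they index cylinder points
  have hcount : ((Finset.univ.filter fun m => dP m ≠ 0).card : ℝ) ≤ 100 * ρ ^ 2 * ((q₂ : ℝ) - q₁) := by
    set Cf : Finset (Fin N') := Finset.univ.filter fun m => dP m ≠ 0 with hCf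
    set τ3 : Fin N' → ℤ × ℤ × ℤ := fun m => (nn m, ee m, ff m) with hτ3
    have hinjOn : Set.InjOn τ3 Cf := fun m _ m' _ h0 => hinjτ m m' h0
    have hT : ∀ t ∈ Cf.image τ3, q₁ < t.1 ∧ t.1 < q₂ ∧
        (barlowPos a h s t.1 t.2.1 t.2.2 0 - barlowPos a h s q₁ i₀ j₀ 0) ^ 2 +
          (barlowPos a h s t.1 t.2.1 t.2.2 1 - barlowPos a h s q₁ i₀ j₀ 1) ^ 2 ≤ ρ ^ 2 := by
      intro t ht
      obtain ⟨m, hm, rfl⟩ := Finset.mem_image.1 ht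
      exact (hdP0 m (Finset.mem_filter.1 hm).2).1
    have hcard := card_le_of_lateral_sq_le ha (by linarith) s hq.le i₀ j₀ (Cf.image τ3) hT
    have hρa : (8 * ρ / a + 1) ^ 2 ≤ 100 * ρ ^ 2 := by
      have h1 : 8 * ρ / a ≤ 9 * ρ := by
        rw [div_le_iff₀ ha]
        have := mul_le_mul_of_nonneg_right (show (8 : ℝ) ≤ 9 * a by linarith only [ha0])
          (show (0 : ℝ) ≤ ρ by linarith only [hρ])
        linarith only [this]
      have h2 : 0 ≤ 8 * ρ / a := by positivity
      calc (8 * ρ / a + 1) ^ 2 ≤ (10 * ρ) ^ 2 :=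
            pow_le_pow_left₀ (by linarith only [h2]) (by linarith only [h1, hρ]) 2
        _ = 100 * ρ ^ 2 := by ring
    rw [← Finset.card_image_of_injOn hinjOn]
    calc ((Cf.image τ3).card : ℝ) ≤ ((q₂ : ℝ) - q₁) * (8 * ρ / a + 1) ^ 2 := hcard
      _ ≤ ((q₂ : ℝ) - q₁) * (100 * ρ ^ 2) := mul_le_mul_of_nonneg_left hρa hq0
      _ = 100 * ρ ^ 2 * ((q₂ : ℝ) - q₁) := by ring
  -- assembly
  have hh3 : ((K : ℝ) * h)⁻¹ ^ 3 ≤ 3 * (K : ℝ)⁻¹ ^ 3 := by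
    rw [mul_inv, mul_pow]
    have h1 : h⁻¹ ≤ 10 / 7 := by
      rw [inv_le_comm₀ hh (by norm_num)]
      linarith only [hh7]
    have h2 : h⁻¹ ^ 3 ≤ 3 :=
      calc h⁻¹ ^ 3 ≤ (10 / 7) ^ 3 := pow_le_pow_left₀ (inv_nonneg.2 hh.le) h1 3
        _ ≤ 3 := by norm_num
    have hK0 : 0 ≤ (K : ℝ)⁻¹ ^ 3 := by positivity
    calc (K : ℝ)⁻¹ ^ 3 * h⁻¹ ^ 3 ≤ (K : ℝ)⁻¹ ^ 3 * 3 := mul_le_mul_of_nonneg_left h2 hK0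
      _ = 3 * (K : ℝ)⁻¹ ^ 3 := by ring
  have hfac : 2000 * CL * r₀⁻¹ ^ 6 * ε₁ + 195 * CT * ((K : ℝ) * h)⁻¹ ^ 3 ≤
      2000 * CL * r₀⁻¹ ^ 6 * ε₁ + 195 * CT * (3 * (K : ℝ)⁻¹ ^ 3) := by
    have := mul_le_mul_of_nonneg_left hh3 (by positivity : (0 : ℝ) ≤ 195 * CT)
    linarith only [this]
  have hfac0 : 0 ≤ 2000 * CL * r₀⁻¹ ^ 6 * ε₁ + 195 * CT * ((K : ℝ) * h)⁻¹ ^ 3 := by positivity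
  calc |changedPairSum lennardJones x dX - changedPairSum lennardJones P dP|
      ≤ ((Finset.univ.filter fun m => dP m ≠ 0).card : ℝ) *
          (2000 * CL * r₀⁻¹ ^ 6 * ε₁ + 195 * CT * ((K : ℝ) * h)⁻¹ ^ 3) := hmain
    _ ≤ (100 * ρ ^ 2 * ((q₂ : ℝ) - q₁)) *
          (2000 * CL * r₀⁻¹ ^ 6 * ε₁ + 195 * CT * (3 * (K : ℝ)⁻¹ ^ 3)) :=
        mul_le_mul hcount hfac hfac0 (by positivity)
    _ = _ := by ring

end Summit.AtomisticToContinuum.Crystallization.Theorems.SquareWellLayerCake.StackingFaultSparsity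

end
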